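import Mathlib
import Literature.RingTheory.CohomologyAnnihilator.TowerBasic
import HarnessLib

/-!
# Rung S-2 `PersistenceSurface` (stmt-ResolutionOfSingularities-19970) — the LIFTING LEMMA across a hypersurface
# section `S ↠ S/(x)`: maps `K → S/(x)` on a syzygy `K ⊆ (S/(x))ᵐ` extend to `(S/(x))ᵐ` once they lift to `S`

Route `ResolutionOfSingularities/HomologicalConductor`, chain W4.4b, rung S-2 `PersistenceSurface`
(stmt-ResolutionOfSingularities-19970), registered skeleton 1a77c002, stub
`stub_saturationFourSurfaceResidualFour : SaturationFourSurfaceResidual₄`.  [OURS · pure linear/homological algebra;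
AI-written, weaker than expert review; NOT a statement of the manuscript under study (Hironaka 2017).]  DEF-FREE.

PURPOSE.  `…PersistenceSurfaceSaturationGorenstein` (p794975) proves `ca(T) = ca³(T)` at every stage `T` with
`Extⁱ_T(W, T) = 0` for all finitely generated `W` and all `i ≥ 3`.  To DISCHARGE that hypothesis at a
complete-intersection stage `T = S/(f₁, …, f_c)` (`S` regular local) one needs the change-of-rings vanishing
«`x` regular on `S`, `Extʲ_S(·, S) = 0` for `j ≥ n + 1` ⇒ `Extⁱ_{S/(x)}(·, S/(x)) = 0` for `i ≥ n`» [Bruns–Herzog,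
Lemma 3.1.16].  Its heart is the following EXTENSION statement, proved here without any `Ext` on the `S/(x)` side:

* `exists_extension_of_lift` — `S` a commutative ring, `x ∈ S` with `IsSMulRegular S x`, `T := S ⧸ (x)`,
  `K ⊆ Tᵐ` a `T`-submodule, `φ : K →ₗ[T] T`.  Let `p : Sᵐ → Tᵐ` be the reduction and `K_S := p⁻¹(K)`.  If the composite
  `φ̃ : K_S → K → T` LIFTS to an `S`-linear `ψ̃ : K_S → S` (`π ∘ ψ̃ = φ̃`), then `φ` EXTENDS to a `T`-linear
  `ψ : Tᵐ → T`.  Proof: for `v ∈ Sᵐ`, `x • v ∈ K_S` and `π(ψ̃(x • v)) = φ(0) = 0`, so `ψ̃(x • v) = x · θ(v)` for a unique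
  `θ(v)` (`x` regular); `θ` is `S`-linear, agrees with `ψ̃` on `K_S` (`x θ(κ) = ψ̃(xκ) = x ψ̃(κ)`), and
  `ψ(w) := Σᵢ wᵢ · π(θ(eᵢ))` works.
* `exists_lift_of_ext_one_eq_zero` — generic: for a short exact `0 → A → B → C → 0` in `ModuleCat S` and `N` with
  `Ext¹_S(N, A) = 0`, every `N ⟶ C` lifts to `N ⟶ B` (`Ext.covariant_sequence_exact₃` in degree `0`).
* `exists_lift_quotient_of_ext_one_eq_zero` — the case `0 → S —x→ S → S/(x) → 0` (`x` regular): `Ext¹_S(N, S) = 0` ⇒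
  every `S`-linear `N → S/(x)` lifts to `N → S`.
* `exists_extension_of_ext_one_eq_zero` — the two combined: `Ext¹_S(K_S, S) = 0` ⇒ every `φ : K →ₗ[T] T` extends to
  `Tᵐ`.  (With `K = Ω¹_T(V)` for a finitely generated `T`-module `V`, `K_S = Ω¹_S(V)`, so the hypothesis is
  `Ext²_S(V, S) = 0`; the consequence is `Ext¹_T(V, T) = 0` — the assembly into the change-of-rings vanishing and the
  complete-intersection corollary is left to the consumer; see the item's census.)

References (mechanism only): W. Bruns, J. Herzog, *Cohen–Macaulay rings*, rev. ed. 1998, Lemma 3.1.16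
[`BrunsHerzog1998`].
-/

noncomputable section

-- single-problem summit: the doubled namespace component `ResolutionOfSingularities` is forced
set_option linter.dupNamespace false

namespace Summit.ResolutionOfSingularities.ResolutionOfSingularities.Theorems.HomologicalConductor.PersistenceSurfaceSaturationHypersurfaceSectionLift

open CategoryTheory CategoryTheory.Abelian Literature.RingTheory.CohomologyAnnihilator

universe u

/-! ## Generic lifting from `Ext¹ = 0` -/

section Lift

variable {S : Type u} [CommRing S]

/-- **Lifting along a short exact sequence when `Ext¹` vanishes.**  For `0 → A → B → C → 0` short exact in
`ModuleCat S` and an object `N` with `Ext¹_S(N, A) = 0`, every morphism `χ : N ⟶ C` lifts to `N ⟶ B`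
(covariant long exact sequence in degree `0`). [folklore] -/
theorem exists_lift_of_ext_one_eq_zero {Sh : ShortComplex (ModuleCat.{u} S)} (hS : Sh.ShortExact)
    {N : ModuleCat.{u} S} (hN : ∀ e : Ext.{u} N Sh.X₁ 1, e = 0) (χ : N ⟶ Sh.X₃) :
    ∃ l : N ⟶ Sh.X₂, l ≫ Sh.g = χ := by
  obtain ⟨x₂, hx₂⟩ := Ext.covariant_sequence_exact₃ N hS (Ext.mk₀ χ) (zero_add 1) (hN _)
  refine ⟨Ext.addEquiv₀ x₂, ?_⟩
  apply (Ext.mk₀_bijective _ _).1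
  rw [← Ext.mk₀_comp_mk₀, Ext.mk₀_addEquiv₀_apply, hx₂]

/-- **Lifting through `S ↠ S/(x)` for `x` regular.**  If `x ∈ S` is a non-zero-divisor (`IsSMulRegular S x`) and
`N` is an `S`-module with `Ext¹_S(N, S) = 0`, then every `S`-linear map `χ : N → S ⧸ (x)` lifts to an `S`-linear
`l : N → S` with `π ∘ l = χ` (`0 → S —x→ S —π→ S/(x) → 0` is short exact). [cite: BrunsHerzog1998, Lemma 3.1.16] -/
theorem exists_lift_quotient_of_ext_one_eq_zero {x : S} (hx : IsSMulRegular S x)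
    {N : Type u} [AddCommGroup N] [Module S N]
    (hN : ∀ e : Ext.{u} (ModuleCat.of S N) (ModuleCat.of S S) 1, e = 0)
    (χ : N →ₗ[S] S ⧸ Ideal.span ({x} : Set S)) :
    ∃ l : N →ₗ[S] S, ∀ n : N, Ideal.Quotient.mk (Ideal.span ({x} : Set S)) (l n) = χ n := by
  -- the short exact sequence `0 → S —x→ S —π→ S/(x) → 0`
  have hinj : Function.Injective (LinearMap.lsmul S S x) := fun a b h => hx h
  have hsurj : Function.Surjective (Algebra.linearMap S (S ⧸ Ideal.span ({x} : Set S))) :=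
    Ideal.Quotient.mk_surjective
  have hexact : Function.Exact (LinearMap.lsmul S S x) (Algebra.linearMap S (S ⧸ Ideal.span ({x} : Set S))) := by
    intro s
    constructor
    · intro hs
      have hs' : s ∈ Ideal.span ({x} : Set S) := by
        rw [← Ideal.Quotient.eq_zero_iff_mem]
        exact hs
      obtain ⟨a, ha⟩ := Ideal.mem_span_singleton'.mp hs'
      exact ⟨a, by rw [LinearMap.lsmul_apply, smul_eq_mul, mul_comm, ha]⟩
    · rintro ⟨a, rfl⟩
      change Ideal.Quotient.mk _ (x • a) = 0
      rw [Ideal.Quotient.eq_zero_iff_mem, smul_eq_mul]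
      exact Ideal.mul_mem_right _ _ (Ideal.subset_span rfl)
  obtain ⟨w, hSh⟩ := exists_shortExact_of_linearMap (Y := ModuleCat.of S S) (M := ModuleCat.of S S)
    (X := ModuleCat.of S (S ⧸ Ideal.span ({x} : Set S))) (LinearMap.lsmul S S x)
    (Algebra.linearMap S (S ⧸ Ideal.span ({x} : Set S))) hinj hsurj hexact
  obtain ⟨l, hl⟩ := exists_lift_of_ext_one_eq_zero hSh (N := ModuleCat.of S N) hN (ModuleCat.ofHom χ)
  refine ⟨l.hom, fun n => ?_⟩
  have h := congrArg (fun f => f.hom n) hl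
  simp only [ModuleCat.hom_comp, LinearMap.comp_apply, ModuleCat.hom_ofHom] at h
  simpa [Algebra.linearMap_apply, Ideal.Quotient.algebraMap_eq] using h

end Lift

/-! ## The extension across the section -/

section Extension

variable {S : Type u} [CommRing S]

/-- **Extension across a hypersurface section, from a lift.**  `x ∈ S` regular, `T := S ⧸ (x)`,
`p : Sᵐ → Tᵐ` the coordinatewise reduction (any `S`-linear map with `p v i = π(v i)`), `K ⊆ Tᵐ` a `T`-submodule,
`φ : K →ₗ[T] T`, `K_S := p⁻¹(K)`.  If the composite `K_S → K → T` lifts to an `S`-linear `ψ̃ : K_S → S`, then `φ`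
extends to a `T`-linear map `Tᵐ → T`. [cite: BrunsHerzog1998, Lemma 3.1.16] -/
theorem exists_extension_of_lift {x : S} (hx : IsSMulRegular S x) {m : ℕ}
    (p : (Fin m → S) →ₗ[S] (Fin m → S ⧸ Ideal.span ({x} : Set S)))
    (hp : ∀ (v : Fin m → S) (i : Fin m), p v i = Ideal.Quotient.mk (Ideal.span ({x} : Set S)) (v i))
    (K : Submodule (S ⧸ Ideal.span ({x} : Set S)) (Fin m → S ⧸ Ideal.span ({x} : Set S)))
    (φ : K →ₗ[S ⧸ Ideal.span ({x} : Set S)] (S ⧸ Ideal.span ({x} : Set S)))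
    (ψt : ((K.restrictScalars S).comap p) →ₗ[S] S)
    (hψt : ∀ κ : (K.restrictScalars S).comap p,
      Ideal.Quotient.mk (Ideal.span ({x} : Set S)) (ψt κ) = φ ⟨p κ, κ.2⟩) :
    ∃ ψ : (Fin m → S ⧸ Ideal.span ({x} : Set S)) →ₗ[S ⧸ Ideal.span ({x} : Set S)] (S ⧸ Ideal.span ({x} : Set S)),
      ∀ k : K, ψ k = φ k := by
  -- `x • v ∈ K_S` for every `v`, since `p (x • v) = 0`
  have hpx : ∀ v : Fin m → S, p (x • v) = 0 := by
    intro v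
    ext i
    rw [hp, Pi.smul_apply, Pi.zero_apply, Ideal.Quotient.eq_zero_iff_mem, smul_eq_mul]
    exact Ideal.mul_mem_right _ _ (Ideal.subset_span rfl)
  have hxmem : ∀ v : Fin m → S, x • v ∈ (K.restrictScalars S).comap p := by
    intro v
    rw [Submodule.mem_comap, hpx v]
    exact zero_mem _
  -- `ψ̃ (x • v) ∈ (x)`: it reduces to `φ 0 = 0`
  have hψx : ∀ v : Fin m → S, ∃ a : S, x * a = ψt ⟨x • v, hxmem v⟩ := by
    intro v
    have h0 : (⟨p (x • v), hxmem v⟩ : K) = 0 := by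
      ext1
      exact hpx v
    have h1 := hψt ⟨x • v, hxmem v⟩
    rw [h0, map_zero, Ideal.Quotient.eq_zero_iff_mem] at h1
    obtain ⟨a, ha⟩ := Ideal.mem_span_singleton'.mp h1
    exact ⟨a, by rw [mul_comm, ha]⟩
  choose θ hθ using hψx
  -- `θ` is `S`-linear, by regularity of `x`
  have hθ_add : ∀ v w, θ (v + w) = θ v + θ w := by
    intro v w
    apply hx
    change x • θ (v + w) = x • (θ v + θ w)
    rw [smul_eq_mul, smul_eq_mul, mul_add, hθ, hθ, hθ, ← map_add]
    congr 1
    ext1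
    exact smul_add x v w
  have hθ_smul : ∀ (c : S) v, θ (c • v) = c * θ v := by
    intro c v
    apply hx
    change x • θ (c • v) = x • (c * θ v)
    rw [smul_eq_mul, smul_eq_mul, hθ, mul_left_comm, hθ, ← smul_eq_mul c, ← map_smul]
    congr 1
    ext1
    exact smul_comm x c v
  let θl : (Fin m → S) →ₗ[S] S :=
    { toFun := θ
      map_add' := hθ_add
      map_smul' := fun c v => by rw [hθ_smul, smul_eq_mul, RingHom.id_apply] }
  have hθl : ∀ v, θl v = θ v := fun _ => rfl
  -- `θ` agrees with `ψ̃` on `K_S`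
  have hθK : ∀ κ : (K.restrictScalars S).comap p, θ κ = ψt κ := by
    intro κ
    apply hx
    change x • θ κ = x • ψt κ
    rw [smul_eq_mul, hθ, ← map_smul]
    rfl
  -- the extension: `ψ w = Σᵢ π (θ eᵢ) · wᵢ`
  refine ⟨∑ i : Fin m, (Ideal.Quotient.mk (Ideal.span ({x} : Set S)) (θ (Pi.single i 1))) •
    LinearMap.proj (R := S ⧸ Ideal.span ({x} : Set S)) i, fun k => ?_⟩
  -- choose a lift `κ ∈ Sᵐ` of `k`
  have hk : ∃ κ : Fin m → S, p κ = (k : Fin m → S ⧸ Ideal.span ({x} : Set S)) := by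
    choose g hg using fun i => Ideal.Quotient.mk_surjective ((k : Fin m → S ⧸ Ideal.span ({x} : Set S)) i)
    exact ⟨g, funext fun i => by rw [hp, hg]⟩
  obtain ⟨κ, hκ⟩ := hk
  have hκS : κ ∈ (K.restrictScalars S).comap p := by
    rw [Submodule.mem_comap, hκ]
    exact k.2
  have hki : ∀ i, (k : Fin m → S ⧸ Ideal.span ({x} : Set S)) i = Ideal.Quotient.mk _ (κ i) := fun i => by
    rw [← hκ, hp]
  -- evaluate the sum at `k`
  have h1 : (∑ i : Fin m, (Ideal.Quotient.mk (Ideal.span ({x} : Set S)) (θ (Pi.single i 1))) •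
      LinearMap.proj (R := S ⧸ Ideal.span ({x} : Set S)) i) (k : Fin m → S ⧸ Ideal.span ({x} : Set S)) =
      ∑ i : Fin m, Ideal.Quotient.mk (Ideal.span ({x} : Set S)) (θ (Pi.single i 1)) *
        (k : Fin m → S ⧸ Ideal.span ({x} : Set S)) i := by
    rw [LinearMap.sum_apply]
    exact Finset.sum_congr rfl fun i _ => rfl
  have h2 : ∑ i : Fin m, Ideal.Quotient.mk (Ideal.span ({x} : Set S)) (θ (Pi.single i 1)) *
        (k : Fin m → S ⧸ Ideal.span ({x} : Set S)) i =
      Ideal.Quotient.mk (Ideal.span ({x} : Set S)) (∑ i : Fin m, κ i * θ (Pi.single i 1)) := by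
    rw [map_sum]
    exact Finset.sum_congr rfl fun i _ => by rw [hki, ← map_mul, mul_comm]
  have hdecomp : (∑ i : Fin m, κ i • (Pi.single i 1 : Fin m → S)) = κ := by
    ext j
    simp [Finset.sum_apply, Pi.single_apply]
  have h3 : ∑ i : Fin m, κ i * θ (Pi.single i 1) = θ κ := by
    calc ∑ i : Fin m, κ i * θ (Pi.single i 1) = ∑ i : Fin m, θl (κ i • Pi.single i 1) :=
          Finset.sum_congr rfl fun i _ => by rw [map_smul, smul_eq_mul, hθl]
      _ = θl (∑ i : Fin m, κ i • Pi.single i 1) := (map_sum θl _ _).symm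
      _ = θ κ := by rw [hdecomp, hθl]
  rw [h1, h2, h3, hθK ⟨κ, hκS⟩, hψt ⟨κ, hκS⟩]
  congr 1
  ext1
  exact hκ

/-- **Extension across a hypersurface section from `Ext¹_S(K_S, S) = 0`.**  `x ∈ S` regular, `T := S ⧸ (x)`,
`p : Sᵐ → Tᵐ` the coordinatewise reduction, `K ⊆ Tᵐ` a `T`-submodule with preimage `K_S := p⁻¹(K) ⊆ Sᵐ`; if
`Ext¹_S(K_S, S) = 0` then every `T`-linear `φ : K → T` extends to `Tᵐ` (lift `K_S → K → T` to `S` by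
`exists_lift_quotient_of_ext_one_eq_zero`, then `exists_extension_of_lift`).  With `K = Ω¹_T(V)`, `K_S = Ω¹_S(V)`:
hypothesis `Ext²_S(V, S) = 0`, conclusion «`Ext¹_T(V, T) = 0`» in extension form. [cite: BrunsHerzog1998, Lemma 3.1.16] -/
theorem exists_extension_of_ext_one_eq_zero {x : S} (hx : IsSMulRegular S x) {m : ℕ}
    (p : (Fin m → S) →ₗ[S] (Fin m → S ⧸ Ideal.span ({x} : Set S)))
    (hp : ∀ (v : Fin m → S) (i : Fin m), p v i = Ideal.Quotient.mk (Ideal.span ({x} : Set S)) (v i))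
    (K : Submodule (S ⧸ Ideal.span ({x} : Set S)) (Fin m → S ⧸ Ideal.span ({x} : Set S)))
    (φ : K →ₗ[S ⧸ Ideal.span ({x} : Set S)] (S ⧸ Ideal.span ({x} : Set S)))
    (hExt : ∀ e : Ext.{u} (ModuleCat.of S ((K.restrictScalars S).comap p)) (ModuleCat.of S S) 1, e = 0) :
    ∃ ψ : (Fin m → S ⧸ Ideal.span ({x} : Set S)) →ₗ[S ⧸ Ideal.span ({x} : Set S)] (S ⧸ Ideal.span ({x} : Set S)),
      ∀ k : K, ψ k = φ k := by
  -- the composite `K_S → K → T`, `S`-linearly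
  let φt : ((K.restrictScalars S).comap p) →ₗ[S] (S ⧸ Ideal.span ({x} : Set S)) :=
    (φ.restrictScalars S) ∘ₗ (p.restrict (p := (K.restrictScalars S).comap p)
      (q := K.restrictScalars S) fun v hv => hv)
  obtain ⟨ψt, hψt⟩ := exists_lift_quotient_of_ext_one_eq_zero hx hExt φt
  exact exists_extension_of_lift hx p hp K φ ψt fun κ => by rw [hψt]; rfl

/-- The coordinatewise reduction `Sᵐ → (S ⧸ I)ᵐ` as an `S`-linear map, with its defining equation (for use as the
argument `p` above). [folklore] -/
theorem compLeft_algebraLinearMap_apply (I : Ideal S) {m : ℕ} (v : Fin m → S) (i : Fin m) :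
    (Algebra.linearMap S (S ⧸ I)).compLeft (Fin m) v i = Ideal.Quotient.mk I (v i) := rfl

end Extension

/-! ## `Ext` bookkeeping for the change of rings (appended): extension property ⇒ `Ext¹ = 0`; degree shifts -/

section ExtShift

variable {R : Type u} [CommRing R]

/-- **The extension property gives `Ext¹ = 0`.**  For `0 → K —f→ P —g→ V → 0` short exact in `ModuleCat R` with `P`
projective: if every morphism `K ⟶ L` extends over `f` to `P ⟶ L`, then `Ext¹(V, L) = 0` (a class of `Ext¹(V, L)`
dies on `P`, so it is `∂φ` for some `φ : K ⟶ L`, and `∂(f ≫ ψ) = 0`).  This converts the conclusion of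
`exists_extension_of_ext_one_eq_zero` into `Ext¹_{S/(x)}(V, S/(x)) = 0`. [folklore] -/
theorem ext_one_eq_zero_of_forall_exists_extension {K P V : ModuleCat.{u} R} {f : K ⟶ P} {g : P ⟶ V}
    {w : f ≫ g = 0} (hS : (ShortComplex.mk f g w).ShortExact) (hP : Projective P) (L : ModuleCat.{u} R)
    (hext : ∀ φ : K ⟶ L, ∃ ψ : P ⟶ L, f ≫ ψ = φ) (e : Ext.{u} V L 1) : e = 0 := by
  haveI : Projective (ShortComplex.mk f g w).X₂ := hP
  have hx₃ : (Ext.mk₀ (ShortComplex.mk f g w).g).comp e (zero_add 1) = 0 := Ext.eq_zero_of_projective _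
  obtain ⟨x₁, hx₁⟩ := Ext.contravariant_sequence_exact₃ hS L e hx₃ (n₀ := 0) (zero_add 1)
  obtain ⟨ψ, hψ⟩ := hext (Ext.addEquiv₀ x₁)
  have hx₁' : x₁ = (Ext.mk₀ (ShortComplex.mk f g w).f).comp (Ext.mk₀ ψ) (zero_add 0) := by
    rw [Ext.mk₀_comp_mk₀]
    change x₁ = Ext.mk₀ (f ≫ ψ)
    rw [hψ, Ext.mk₀_addEquiv₀_apply]
  rw [← hx₁, hx₁']
  exact hS.extClass_comp_assoc (γ := Ext.mk₀ ψ)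

/-- **Degree shift along a short exact sequence with an acyclic middle.**  For `0 → K → P → V → 0` short exact and
`i : ℕ`: if `Extⁱ⁺¹(P, L) = 0` and `Extⁱ(K, L) = 0` then `Extⁱ⁺¹(V, L) = 0`.  (With `P` projective over `S/(x)` this is
the upward shift on the `S/(x)` side; with `P` the restriction of a free `S/(x)`-module to `S` — of projective dimension
`≤ 1` over `S`, so `Extʲ_S(P, ·) = 0` for `j ≥ 2` — it is the shift on the `S` side.) [folklore] -/
theorem ext_succ_eq_zero_of_shortExact {K P V : ModuleCat.{u} R} {f : K ⟶ P} {g : P ⟶ V} {w : f ≫ g = 0}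
    (hS : (ShortComplex.mk f g w).ShortExact) (L : ModuleCat.{u} R) {i : ℕ}
    (hP : ∀ e : Ext.{u} P L (i + 1), e = 0) (hK : ∀ e : Ext.{u} K L i, e = 0) (e : Ext.{u} V L (i + 1)) :
    e = 0 := by
  have hx₃ : (Ext.mk₀ (ShortComplex.mk f g w).g).comp e (zero_add (i + 1)) = 0 := hP _
  obtain ⟨x₁, hx₁⟩ := Ext.contravariant_sequence_exact₃ hS L e hx₃ (n₀ := i) (add_comm 1 i)
  rw [← hx₁, hK x₁, Ext.comp_zero]

/-- **Upward shift along a projective cover**: `0 → K → P → V → 0` short exact with `P` projective,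
`Extⁱ(K, L) = 0`, `i ≥ 1` ⇒ `Extⁱ⁺¹(V, L) = 0`. [cite: IyengarTakahashi2014, Remark 2.3] -/
theorem ext_succ_eq_zero_of_shortExact_projective {K P V : ModuleCat.{u} R} {f : K ⟶ P} {g : P ⟶ V}
    {w : f ≫ g = 0} (hS : (ShortComplex.mk f g w).ShortExact) (hP : Projective P) (L : ModuleCat.{u} R)
    {i : ℕ} (hK : ∀ e : Ext.{u} K L i, e = 0) (e : Ext.{u} V L (i + 1)) : e = 0 :=
  haveI : Projective P := hP
  ext_succ_eq_zero_of_shortExact hS L (fun e' => Ext.eq_zero_of_projective e') hK e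

end ExtShift

end Summit.ResolutionOfSingularities.ResolutionOfSingularities.Theorems.HomologicalConductor.PersistenceSurfaceSaturationHypersurfaceSectionLift

end
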